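import Summits.BirchSwinnertonDyer.Rank1Residual.Partition.CornersSemistableSharp
import Literature.NumberTheory.EllipticCurves.Rank1Residual.PPartGoodOrdinarySurj
import HarnessLib

/-!
# The FLAG-FREE sub-locus of the covered good-ordinary rows: where `BSD(E,p)` follows from refereed
# theorems with NO preprint input, and hence where exactly the PUB\* facts are load-bearing
# (cell `b2b-bsdres`, RESIDUAL-MAP.md §A table 'flag-free sub-cells' and §I REFEREEING DEBT; rmap-1 gen 6)

HONEST FRAMING (run/shared/lean/b2b/bsd-rank1-residual/, verbatim in every file): the goal of the
cell is to DELETE the COMBINATION-SHAPED residual classes of the Birch–Swinnerton-Dyer formula for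
ALL analytic-rank `≤ 1` elliptic curves over `ℚ` — "full BSD formula for every rank `≤ 1` curve in
class `C`" assembled STRICTLY from published theorems — so that the rank-`≤ 1` remainder becomes
exactly the CONSTRUCTION-SHAPED classes, which are TYPED (missing-input `Prop`s), NOT attempted.
This is not "finishing BSD". Theorems only; NO definition, NO named fact introduced here; every
published theorem enters as one of the tree's existing named Literature facts BY NAME; nothing
about any particular curve is asserted; no label changes; no census number moves.

RESIDUAL-MAP §A marks the rows 'surjective, `p = 3`' and 'surjective, `p ∈ {5, 7, ≥ 11}`' COVERED
[PUB\*]: the printed statements of record — Yan–Zhu 2026 Thm. 4.15 (`hYZ`, flag `YZ26@3-BF-ERL-Ohta`)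
and Burungale–Castella–Skinner 2025 Cor. 1.3.1 (`hBCS`, flag `BCS25-IMC-equiv@BSTW`) — are refereed
but one input of their printed proofs is a preprint.  The same table lists FLAG-FREE [PUB]
sub-cells, covered by refereed theorems with no such input:

* rank `0`, (ram) holds (a multiplicative `ℓ ≠ p` with `p ∤ ord_ℓ(Δ_min)`): T2 = Skinner 2016
  Thm. C (`hSk`; also T1 = Skinner–Urban 2014 Thm. 2 (a) in the surjective case) —
  `bsdp_goodOrd_rankZero_of_irr_of_ram`;
* rank `1`, `E` semistable: T4 = Jetchev–Skinner–Wan 2017 Thm. 1.2.1 (`hJSW`; PUB at an ordinary `p`,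
  referee R123.2's informational `Hid04-gap` travelling with it) —
  `bsdp_goodOrd_rankOne_of_semistable_of_irr_sharp` (`CornersSemistableSharp`);
* rank `1`, `p ≥ 5`, `ρ̄_{E,p}` onto and W. Zhang's local conditions zhang(p) = Thm. 1.4 (2) + (3):
  T5 = W. Zhang 2014 Thm. 1.6 (`hZ` = `WZhang2014_padicValRat_bsd_rank_one_ordinary`; PUB,
  Beilinson–Flach-free) — x9/pub's `bsdp_rankOne_of_WZhang2014`.

`bsdp_goodOrd_of_irr_of_flagFreeWitness` assembles them: **for every `E/ℚ` of analytic rank `≤ 1`,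
every odd good ORDINARY `p` with `E[p]` irreducible, and a FLAG-FREE WITNESS
`(r = 0 ∧ ram) ∨ (r = 1 ∧ sst) ∨ (r = 1 ∧ p ≥ 5 ∧ surj ∧ zhang(p))`, `BSD(E,p)` holds from `hSk`,
`hJSW`, `hZ`, modularity and GZK alone** — no `hBCS`, no `hYZ`.  Consequently (bookkeeping, not a
ruling): on the irreducible covered rows of §A the PUB\* facts are LOAD-BEARING exactly on the
complement `irr ∧ ¬witness`, i.e. on `(r = 0 ∧ ¬ram) ∨ (r = 1 ∧ ¬sst ∧ ¬(p ≥ 5 ∧ surj ∧ zhang(p)))`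
— RESIDUAL-MAP §I's "`BCS25-IMC-equiv@BSTW`: §A surjective ¬ram `r = 0` / `r = 1` 'rest'" with
'rest' made explicit and DECIDABLE per pair (every atom is a finite check on `N`, `Δ_min` and the
mod-`p` image).  The witness predicate is written inline (no definition is introduced).

References: RESIDUAL-MAP.md §A (table, register T1/T2/T4/T5), §I REFEREEING DEBT;
`Partition/Corners.lean` (`RowC1.bsdp`), `Partition/CornersSemistableSharp.lean`,
`Literature/…/Rank1Residual/PPartGoodOrdinarySurj.lean` (route (P1′) of the pub cell, referee A
R151.2); Skinner 2016 Thm. C; Jetchev–Skinner–Wan 2017 Thm. 1.2.1; W. Zhang 2014 Thm. 1.4 / 1.6.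
-/

namespace Summit.BirchSwinnertonDyer.Rank1Residual

open WeierstrassCurve Literature.NumberTheory.EllipticCurves
  Literature.NumberTheory.EllipticCurves.Rank1Residual Literature.NumberTheory.EllipticCurves.ModularForms
  Literature.NumberTheory.EllipticCurves.SkinnerUrban2014 Literature.NumberTheory.Automorphic
open scoped NumberField

section Curve

variable {W : WeierstrassCurve ℚ} [W.IsElliptic] [W.IsGloballyMinimal] {p : ℕ} [Fact p.Prime]

/-- **Rank `0`, odd good ORDINARY `p`, `E[p]` irreducible, (ram) ⇒ `BSD(E,p)` — flag-free [PUB],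
THREE named facts.**  Row C1 = Skinner 2016 Thm. C (`hSk`: "good ordinary or multiplicative
reduction at a prime `p ≥ 3` … (i) `E[p]` irreducible; (ii) there exists a prime `q ≠ p` at which
`E` has multiplicative reduction and `E[p]` is ramified. If `L(E,1) ≠ 0` then
`|L(E,1)/Ω_E|_p⁻¹ = |#Ш(E)∏ c_ℓ(E)|_p⁻¹`"), read through modularity (`hmod`) and GZK (`hGZK`); the
good-ordinary twin of `Corners.bsdp_mult_rankZero_of_irr_of_ram`.  This is RESIDUAL-MAP §A's
'flag-free [PUB] sub-cell: (ram) by T2 / T1' of the surjective rows, image-free (no surjectivity is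
needed by T2). [cite: Skinner2016PacificMC, Thm. C (§1)] -/
theorem bsdp_goodOrd_rankZero_of_irr_of_ram (hSk : Skinner2016.thmC_padicValRat_bsd_rank_zero)
    (hmod : hasEntireLFunction_rat) (hGZK : rank_eq_analyticRank_of_analyticRank_le_one)
    (hr0 : W.analyticRank = 0) (hp : p ≠ 2) (hgo : GoodOrd W p) (hirr : Irr W p) (hram : Ram W p) :
    BSDp W p :=
  RowC1.bsdp hSk hmod hGZK ⟨hr0, three_le_of_ne_two hp, Or.inl hgo, hirr, hram⟩

/-- **FLAG-FREE WITNESS ⇒ `BSD(E,p)` on the good ORDINARY axis, from refereed theorems with no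
preprint input.**  For every `E/ℚ` (globally minimal `W`) of analytic rank `r ≤ 1`, every odd prime
`p` of good ordinary reduction with `E[p]` irreducible, and a witness of one of the three flag-free
sub-cells of RESIDUAL-MAP §A —
(a) `r = 0 ∧ ram(p)` (T2 = Skinner 2016 Thm. C, `hSk`);
(b) `r = 1 ∧ E semistable` (T4 = Jetchev–Skinner–Wan 2017 Thm. 1.2.1, `hJSW`; the `p = 3` proviso
    is vacuous at an ordinary `3`; informational flag `Hid04-gap` travels with `hJSW`);
(c) `r = 1 ∧ p ≥ 5 ∧ ρ̄_{E,p}` onto `∧` zhang(p), where zhang(p) = W. Zhang 2014 Thm. 1.4 (2) "if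
    `ℓ ≡ ±1 mod p` and `ℓ ‖ N`, then `ρ̄_{E,p}` is ramified at `ℓ`" and (3) "if `N` is not
    square-free, then `#Ram(ρ̄_{E,p}) ≥ 1` and when `#Ram(ρ̄_{E,p}) = 1`, there are even number of
    prime factors `ℓ ‖ N`", transcribed as in the tree fact (T5 = W. Zhang 2014 Thm. 1.6, `hZ`) —
`BSD(E,p)` holds, granted `hSk`, `hJSW`, `hZ`, modularity (`hmod`) and GZK (`hGZK`).  Neither
Burungale–Castella–Skinner 2025 (`hBCS`, PUB\*) nor Yan–Zhu 2026 (`hYZ`, PUB\*) is a binder: on the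
irreducible covered rows of §A those facts are load-bearing only OFF this witness.
[cite: Skinner2016PacificMC, Thm. C (§1)] [cite: JetchevSkinnerWan2017, Thm. 1.2.1 (§1.2)]
[cite: WZhang2014, Thm. 1.4 (p. 197), Thm. 1.6 (p. 199)] -/
theorem bsdp_goodOrd_of_irr_of_flagFreeWitness
    (hSk : Skinner2016.thmC_padicValRat_bsd_rank_zero)
    (hJSW : JetchevSkinnerWan2017.thm121_padicValRat_bsd_rank_one)
    (hZ : WZhang2014_padicValRat_bsd_rank_one_ordinary)
    (hmod : hasEntireLFunction_rat) (hGZK : rank_eq_analyticRank_of_analyticRank_le_one)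
    (hp : p ≠ 2) (hgo : GoodOrd W p) (hirr : Irr W p)
    (hw : (W.analyticRank = 0 ∧ Ram W p) ∨ (W.analyticRank = 1 ∧ Semistable W) ∨
      (W.analyticRank = 1 ∧ 5 ≤ p ∧ Surj W p ∧
        (∀ (ℓ : ℕ) [Fact ℓ.Prime], W.HasMultiplicativeReductionAtPrime ℓ →
          (p ∣ ℓ - 1 ∨ p ∣ ℓ + 1) → ¬ p ∣ padicValInt ℓ W.minimalDiscriminantInt) ∧
        (¬ W.IsSemistable ℤ →
          (∃ ℓ : ℕ, ∃ _ : Fact ℓ.Prime, W.HasMultiplicativeReductionAtPrime ℓ ∧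
              ¬ p ∣ padicValInt ℓ W.minimalDiscriminantInt) ∧
            (Set.ncard {ℓ : ℕ | ∃ _ : Fact ℓ.Prime, W.HasMultiplicativeReductionAtPrime ℓ ∧
                ¬ p ∣ padicValInt ℓ W.minimalDiscriminantInt} = 1 →
              Even (Set.ncard {ℓ : ℕ | ∃ _ : Fact ℓ.Prime,
                W.HasMultiplicativeReductionAtPrime ℓ}))))) :
    BSDp W p := by
  rcases hw with ⟨hr0, hram⟩ | ⟨hr1, hsst⟩ | ⟨hr1, h5, hsurj, h2, h3⟩
  · exact bsdp_goodOrd_rankZero_of_irr_of_ram hSk hmod hGZK hr0 hp hgo hirr hram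
  · exact bsdp_goodOrd_rankOne_of_semistable_of_irr_sharp hJSW hmod hGZK hr1 hp hsst hgo hirr
  · exact bsdp_rankOne_of_WZhang2014 W p hZ hmod hGZK h5 hgo hsurj h2 h3 hr1

/-- **Surjective image, `p ≥ 5` good ordinary: the preprint-free coverage of the row 'surjective,
`p ∈ {5, 7, ≥ 11}`' for a possibly NON-semistable curve is (a) ∨ (c).**  For `E/ℚ` with `ρ̄_{E,p}`
onto at a good ordinary `p ≥ 5` (so `E[p]` is irreducible,
`hasIrreducibleModPGaloisRep_of_hasSurjectiveModNGaloisRep`): `r = 0 ∧ ram(p)` (T2, `hSk`) or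
`r = 1 ∧ zhang(p)` (T5, `hZ`) ⇒ `BSD(E,p)`, with modularity and GZK — no `hBCS`.  (The semistable
rank-one curves are sub-cell (b) of `bsdp_goodOrd_of_irr_of_flagFreeWitness`.)
[cite: Skinner2016PacificMC, Thm. C (§1)] [cite: WZhang2014, Thm. 1.4 (p. 197), Thm. 1.6 (p. 199)] -/
theorem bsdp_goodOrd_of_surj_of_ram_or_zhang
    (hSk : Skinner2016.thmC_padicValRat_bsd_rank_zero)
    (hZ : WZhang2014_padicValRat_bsd_rank_one_ordinary)
    (hmod : hasEntireLFunction_rat) (hGZK : rank_eq_analyticRank_of_analyticRank_le_one)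
    (h5 : 5 ≤ p) (hgo : GoodOrd W p) (hsurj : Surj W p)
    (hw : (W.analyticRank = 0 ∧ Ram W p) ∨
      (W.analyticRank = 1 ∧
        (∀ (ℓ : ℕ) [Fact ℓ.Prime], W.HasMultiplicativeReductionAtPrime ℓ →
          (p ∣ ℓ - 1 ∨ p ∣ ℓ + 1) → ¬ p ∣ padicValInt ℓ W.minimalDiscriminantInt) ∧
        (¬ W.IsSemistable ℤ →
          (∃ ℓ : ℕ, ∃ _ : Fact ℓ.Prime, W.HasMultiplicativeReductionAtPrime ℓ ∧
              ¬ p ∣ padicValInt ℓ W.minimalDiscriminantInt) ∧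
            (Set.ncard {ℓ : ℕ | ∃ _ : Fact ℓ.Prime, W.HasMultiplicativeReductionAtPrime ℓ ∧
                ¬ p ∣ padicValInt ℓ W.minimalDiscriminantInt} = 1 →
              Even (Set.ncard {ℓ : ℕ | ∃ _ : Fact ℓ.Prime,
                W.HasMultiplicativeReductionAtPrime ℓ}))))) :
    BSDp W p := by
  have hirr : Irr W p := hasIrreducibleModPGaloisRep_of_hasSurjectiveModNGaloisRep W p hsurj
  have hp : p ≠ 2 := by omega
  rcases hw with ⟨hr0, hram⟩ | ⟨hr1, h2, h3⟩
  · exact bsdp_goodOrd_rankZero_of_irr_of_ram hSk hmod hGZK hr0 hp hgo hirr hram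
  · exact bsdp_rankOne_of_WZhang2014 W p hZ hmod hGZK h5 hgo hsurj h2 h3 hr1


/-!
### Row D1 re-route (cell `bsd-litref`, tranche T2a, 2026-08-26): the ROW-C2 consumer without `hBCS`

Row C2 of the partition (`RowC2 W p := ¬cm ∧ 3 < p ∧ GoodOrd ∧ Irr ∧ BigIm`, `Partition/Rows.lean`)
is bound to Burungale–Castella–Skinner 2025 Cor. 1.3.1 (`RowC2.bsdp`, binder `hBCS`, PUB\*; census
row D1 = the cells whose ONLY cover is C2, literal under the composite flag
`BCS25-IMC-equiv@BSTW+Wan15-Thm3@Fuj06(unpublished)+Hid04-gap`).  On the sub-locus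
`r = 1 ∧ zhang(p)` the SAME cells are closed by T5 = W. Zhang 2014 Thm. 1.6 (`hZ`, refereed, no
preprint input; Beilinson–Flach-free, [Wan15]/[Fuj06]-free, [Hid04]-free at the page): a row-C2
cell has `p ≥ 5` (a prime `> 3`) and `ρ̄_{E,p}` onto (`Irr ∧ BigIm ⇒ Surj`,
`surj_of_irr_of_bigIm`), which are Zhang's (1) and (4) together with `GoodOrd`; (2) + (3) =
zhang(p) are decided per class from `N` and `Δ_min`.  Two doors: `RowC2.bsdp_rankOne_of_zhang`
(zhang(p) verbatim as the tree fact binds it) and `RowC2.bsdp_rankOne_of_two_ram` (two distinct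
multiplicative primes at which `ρ̄_{E,p}` is ramified discharge (3), as in
`bsdp_of_S30_of_WZhang2014`).  Binders: `hZ`, modularity, GZK — NO `hBCS`, NO `hYZ`.  Nothing
about any particular curve is asserted; no definition, no named fact; no census number moves here
(the re-tiering of D1 cells is referee A's booking on the cell's per-class witness table).
-/

/-- **Row C2, analytic rank one, zhang(p) ⇒ `BSD(E,p)` from W. Zhang 2014 Thm. 1.6 — no `hBCS`.**
For a globally minimal `W/ℚ` and a prime `p` with `RowC2 W p` (non-CM, `p > 3`, good ordinary,
`E[p]` irreducible, (im)), `ord_{s=1} L(E,s) = 1`, and W. Zhang's Thm. 1.4 hypotheses (2) "if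
`ℓ ≡ ±1 mod p` and `ℓ ‖ N`, then `ρ̄_{E,p}` is ramified at `ℓ`" (`h2`) and (3) "if `N` is not
square-free, then `#Ram(ρ̄_{E,p}) ≥ 1` and when `#Ram(ρ̄_{E,p}) = 1`, there are even number of prime
factors `ℓ ‖ N`" (`h3`), transcribed exactly as in the tree fact
`WZhang2014_padicValRat_bsd_rank_one_ordinary` (T5): `BSD(E,p)` holds granted `hZ`, modularity
(`hmod`) and GZK (`hGZK`).  Zhang's (1) `ρ̄_{E,p}` surjective is `surj_of_irr_of_bigIm` (Irr ∧ (im));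
`p ≥ 5` because `p` is a prime `> 3`; (4) is `GoodOrd`.  This is the preprint-free re-route of the
census row D1 on its zhang(p) sub-population (door Z1/Z2 of the cell's witness table).
[cite: WZhang2014, Thm. 1.6 (p. 199), Thm. 1.4 (p. 197), p. 193] -/
theorem RowC2.bsdp_rankOne_of_zhang (hZ : WZhang2014_padicValRat_bsd_rank_one_ordinary)
    (hmod : hasEntireLFunction_rat) (hGZK : rank_eq_analyticRank_of_analyticRank_le_one)
    (h : RowC2 W p) (hr1 : W.analyticRank = 1)
    (h2 : ∀ (ℓ : ℕ) [Fact ℓ.Prime], W.HasMultiplicativeReductionAtPrime ℓ →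
      (p ∣ ℓ - 1 ∨ p ∣ ℓ + 1) → ¬ p ∣ padicValInt ℓ W.minimalDiscriminantInt)
    (h3 : ¬ W.IsSemistable ℤ →
      (∃ ℓ : ℕ, ∃ _ : Fact ℓ.Prime, W.HasMultiplicativeReductionAtPrime ℓ ∧
          ¬ p ∣ padicValInt ℓ W.minimalDiscriminantInt) ∧
        (Set.ncard {ℓ : ℕ | ∃ _ : Fact ℓ.Prime, W.HasMultiplicativeReductionAtPrime ℓ ∧
            ¬ p ∣ padicValInt ℓ W.minimalDiscriminantInt} = 1 →
          Even (Set.ncard {ℓ : ℕ | ∃ _ : Fact ℓ.Prime, W.HasMultiplicativeReductionAtPrime ℓ}))) :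
    BSDp W p := by
  obtain ⟨-, hp3, hgo, hirr, him⟩ := h
  have hp2 : p ≠ 2 := by omega
  have hp3' : p ≠ 3 := by omega
  have h5 : 5 ≤ p := (Fact.out : p.Prime).five_le_of_ne_two_of_ne_three hp2 hp3'
  have hsurj : Surj W p := surj_of_irr_of_bigIm W p hirr him
  exact bsdp_rankOne_of_WZhang2014 W p hZ hmod hGZK h5 hgo hsurj h2 h3 hr1

/-- **Row C2, analytic rank one, zhang(p) with TWO ramified multiplicative primes ⇒ `BSD(E,p)` — no
`hBCS`.**  Same as `RowC2.bsdp_rankOne_of_zhang`, with W. Zhang's (3) discharged by two DISTINCT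
primes `ℓ₁ ≠ ℓ₂` of multiplicative reduction with `p ∤ v_{ℓ_i}(Δ_min)` (`ρ̄_{E,p}` ramified at both,
so `#Ram(ρ̄_{E,p}) ≥ 2` and the parity clause is vacuous — the argument of
`bsdp_of_S30_of_WZhang2014`); (2) is kept verbatim (`h2`).  Door Z2 of the cell's D1 witness table
(`#Ram_p ≥ 2`).  Binders `hZ`, `hmod`, `hGZK` only.
[cite: WZhang2014, Thm. 1.6 (p. 199), Thm. 1.4 (p. 197), p. 193] -/
theorem RowC2.bsdp_rankOne_of_two_ram (hZ : WZhang2014_padicValRat_bsd_rank_one_ordinary)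
    (hmod : hasEntireLFunction_rat) (hGZK : rank_eq_analyticRank_of_analyticRank_le_one)
    (h : RowC2 W p) (hr1 : W.analyticRank = 1)
    (h2 : ∀ (ℓ : ℕ) [Fact ℓ.Prime], W.HasMultiplicativeReductionAtPrime ℓ →
      (p ∣ ℓ - 1 ∨ p ∣ ℓ + 1) → ¬ p ∣ padicValInt ℓ W.minimalDiscriminantInt)
    (htwo : ∃ ℓ₁ ℓ₂ : ℕ, ∃ _ : Fact ℓ₁.Prime, ∃ _ : Fact ℓ₂.Prime, ℓ₁ ≠ ℓ₂ ∧
      W.HasMultiplicativeReductionAtPrime ℓ₁ ∧ ¬ p ∣ padicValInt ℓ₁ W.minimalDiscriminantInt ∧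
      W.HasMultiplicativeReductionAtPrime ℓ₂ ∧ ¬ p ∣ padicValInt ℓ₂ W.minimalDiscriminantInt) :
    BSDp W p := by
  refine RowC2.bsdp_rankOne_of_zhang hZ hmod hGZK h hr1 h2 fun _ ↦ ?_
  obtain ⟨ℓ₁, ℓ₂, i₁, i₂, hne, hm₁, hv₁, hm₂, hv₂⟩ := htwo
  refine ⟨⟨ℓ₁, i₁, hm₁, hv₁⟩, fun hcard ↦ ?_⟩
  -- `#Ram = 1` is impossible: `ℓ₁ ≠ ℓ₂` both lie in `Ram`
  exfalso
  obtain ⟨a, ha⟩ := Set.ncard_eq_one.mp hcard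
  have h₁ : ℓ₁ ∈ ({a} : Set ℕ) := ha ▸ (show ℓ₁ ∈ {ℓ : ℕ | ∃ _ : Fact ℓ.Prime,
    W.HasMultiplicativeReductionAtPrime ℓ ∧ ¬ p ∣ padicValInt ℓ W.minimalDiscriminantInt} from
    ⟨i₁, hm₁, hv₁⟩)
  have h₂ : ℓ₂ ∈ ({a} : Set ℕ) := ha ▸ (show ℓ₂ ∈ {ℓ : ℕ | ∃ _ : Fact ℓ.Prime,
    W.HasMultiplicativeReductionAtPrime ℓ ∧ ¬ p ∣ padicValInt ℓ W.minimalDiscriminantInt} from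
    ⟨i₂, hm₂, hv₂⟩)
  rw [Set.mem_singleton_iff] at h₁ h₂
  exact hne (h₁.trans h₂.symm)

end Curve

end Summit.BirchSwinnertonDyer.Rank1Residual
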